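import Summits.Ventures.PackingBounds.ThreePointCert.K6d10Cert

/-!
# κ(6) ≤ 78: kernel validation of Gram block R1 (chunks 16–19 of 19)

Framing: lottery ticket; floor = certified bounds/negative ranges. Venture `PackingBounds` (cell
`pub-packcert`), three-point SDP family. Integer data of a feasible point of the Bachoc–Vallentin
semidefinite program (n = 6, s = 1/2, degree d = 10, symmetric
sums of squares), derived by `pub-packcert-lp/code/lean3pt/cert2lean_lp.py` (the lp seat's fixed-point
variant of `pub-packcert-sdp/code/lean3pt/cert2lean.py`) from the exact rational certificate
`sdp-d6-deg10-sym-lp-v1.json` of the cell (exact verifier #1 + verifier #2 of the other seat), in the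
units of the kernel checker `ThreePointCert.Check` (soundness `ThreePointCert.Sound`). Generated
file: plain lists of integers / monomials.
-/

namespace Summit.Ventures.PackingBounds.ThreePointCert.K6d10

open Literature.Geometry.DiscreteGeometry Literature.Geometry.DiscreteGeometry.PolyCert PolyCert.SPoly

set_option maxHeartbeats 0 in
/-- Block `R1`: rows from 191 (8 rows) of `zᵀ(LLᵀ)z` added to `dR1c15` give `dR1c16` (kernel). -/
theorem okR1_16 : chunkOK K6d10.gR1 191 8 K6d10.dR1c15 K6d10.dR1c16 = true := by
  decide +kernel

set_option maxHeartbeats 0 in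
/-- Block `R1`: rows from 199 (8 rows) of `zᵀ(LLᵀ)z` added to `dR1c16` give `dR1c17` (kernel). -/
theorem okR1_17 : chunkOK K6d10.gR1 199 8 K6d10.dR1c16 K6d10.dR1c17 = true := by
  decide +kernel

set_option maxHeartbeats 0 in
/-- Block `R1`: rows from 207 (8 rows) of `zᵀ(LLᵀ)z` added to `dR1c17` give `dR1c18` (kernel). -/
theorem okR1_18 : chunkOK K6d10.gR1 207 8 K6d10.dR1c17 K6d10.dR1c18 = true := by
  decide +kernel

set_option maxHeartbeats 0 in
/-- Block `R1`: rows from 215 ((gR1.z.length - 215) rows) of `zᵀ(LLᵀ)z` added to `dR1c18` give `eR1` (kernel). -/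
theorem okR1_19 : chunkOK K6d10.gR1 215 (K6d10.gR1.z.length - 215) K6d10.dR1c18 K6d10.eR1 = true := by
  decide +kernel

end Summit.Ventures.PackingBounds.ThreePointCert.K6d10
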